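import Summits.AtomisticToContinuum.FouriersLaw.Theses.BondHeatUncertainty
import Summits.AtomisticToContinuum.FouriersLaw.Theses.BoundaryEscapeDeficit
import Summits.AtomisticToContinuum.FouriersLaw.Theorems.BondHeatUncertaintySubdiffusiveBondHeatGibbsMomentumFourthMoment
import Summits.AtomisticToContinuum.FouriersLaw.Theorems.BondHeatUncertaintySubdiffusiveBondHeatGibbsPositionEighthMoment
import Summits.AtomisticToContinuum.FouriersLaw.Theorems.BondHeatUncertaintySubdiffusiveBondHeatBathBondReductionConditional
import Summits.AtomisticToContinuum.FouriersLaw.Theorems.BondHeatUncertaintySubdiffusiveBondHeatSiteEnergyDynkin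
import Summits.AtomisticToContinuum.FouriersLaw.Theorems.BondHeatUncertaintySubdiffusiveBondHeatSiteEnergyCurrentCovariance
import Summits.AtomisticToContinuum.FouriersLaw.Theorems.BondHeatUncertaintySubdiffusiveBondHeatKernelDoobTransform
import Summits.AtomisticToContinuum.FouriersLaw.Theorems.BondHeatUncertaintySubdiffusiveBondHeatKernelDetailedBalance
import Summits.AtomisticToContinuum.FouriersLaw.Theorems.BoundaryEscapeDeficitBoundaryKernelBasics
import Summits.AtomisticToContinuum.FouriersLaw.Theorems.BondHeatUncertaintySubdiffusiveBondHeatOfDeficitCesaroEW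
import Summits.AtomisticToContinuum.FouriersLaw.Theorems.BondHeatUncertaintySubdiffusiveBondHeatOfOpenBlockDiffusion
import Summits.AtomisticToContinuum.FouriersLaw.Theorems.BondHeatUncertaintySubdiffusiveBondHeatOfFloorTransient
import Summits.AtomisticToContinuum.FouriersLaw.Theorems.BondHeatUncertaintySubdiffusiveBondHeatDeficitCesaroLinear
import Summits.AtomisticToContinuum.FouriersLaw.Theorems.BondHeatUncertaintySubdiffusiveBondHeatEscapeDeficitNonneg
import Summits.AtomisticToContinuum.FouriersLaw.Theorems.BondHeatUncertaintySubdiffusiveBondHeatOhmicFloorNecessary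
import Summits.AtomisticToContinuum.FouriersLaw.Theorems.BondHeatUncertaintySubdiffusiveBondHeatEscapeDeficitLeOne
import Summits.AtomisticToContinuum.FouriersLaw.Theorems.BondHeatUncertaintySubdiffusiveBondHeatOfContactWarburgModulus

/-!
# Line `bath-bond-deficit-integral` — crux `BondHeatUncertainty.SubdiffusiveBondHeat` (stmt-AtomisticToContinuum-9120)

**LEAD c5 ADDENDUM (prover-line-stmt-AtomisticToContinuum-9120-c5-0, 2026-08-17; the stub set is UNCHANGED: one sorry).**  Landed this
cycle, all `--supports` 9120 and imported above: (i) the CIRCULARITY WITNESS `…IffBoundedResponse` (p152330: `boundedResponse_iff_ohmicFloor`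
— the Ohm half of the open stub IS the route's output stmt-11071 — and `subdiffusiveBondHeat_of_boundedResponse_transientEW`,
`subdiffusiveBondHeat_iff_boundedResponse`); (ii) the SPECTRAL TRANSFER `ContactWarburgModulus ⟹ TransientEW` (`…OfContactWarburgModulus`:
`transientEW_of_contactWarburgModulus`, `subdiffusiveBondHeat_of_boundedResponse_contactWarburgModulus`) over `…SpectralPositivity` (p154021:
weighted second moments along the stationary flow, Fejér positivity `0 ≤ ∫₀ᵗ(t−r)cos(ωr)K_N`), `…SpectralNonneg` (p155205: the boundary
noise spectrum is nonnegative N-uniformly, `0 ≤ ∫₀^∞cos(ωu)K_N`; the Warburg dip `M_N(ω) = (γ/T²)∫(1−cos ωu)K_N ≤ 1 − E_N ≤ 1`),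
`…FejerKernel` (p154748) and `…TransientSpectral` (p155570: `c₁∫₀ᵗ∫_{(s,∞)}K = ∫(1−cos ωt)ω⁻²D_K(ω)dω`).  See the section
"Spectral bridge" at the end of this file: the open stub follows from `OhmicFloor` (⟺ 11071) and `ContactWarburgModulus`
(`M_N(ω) ≤ C√|ω|` for `|ω| ≤ 1`, `N ≥ N₀` — crux-strategist s2's S⁺_G; its `|ω| > 1` half is proved), documentation only, not a reshape.

**RESHAPE of 2026-08-16 (generation-1 lead `prover-line-stmt-AtomisticToContinuum-9120-0`, cycle 1): ONE open stub.**
The two N-uniform stubs of the previous shape (`stub_ohmicFloor`: `E_N ≤ C₁/N`, = EscapeLaw-upper of stmt-12234, and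
`stub_transientEW`: `∫₀ᵗ(1 − θ_N − E_N) ≤ C₂√t`; tree copy `Lines/bath_bond_deficit_integral.lean` of 08:59Z keeps that
shape for reference) are MERGED into the single registered stub `stub_deficitCesaroEW` — the WEAKEST statement the
composition consumes: the once-integrated (Cesàro) Edwards–Wilkinson bound on the boundary escape-deficit curve up to
the Thouless time, `∫₀ᵗ (1 − θ_N(s)) ds ≤ C √t` for `1 ≤ t ≤ cN²`, `N ≥ N₀`, i.e. (by the landed bath-heat identity
`Var_eq(Q^L_t) = 2γT²∫₀ᵗ(1 − θ_N)`) the EW ¼-law of the heat exchanged with ONE reservoir; along this line it is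
EQUIVALENT to (S) at `b = 0` (forward: this file; backward: `Var Q^L ≤ 2 Var ∫j₀ + 8E[e₀²]`, same fixed-N technology,
cf. Disproof.lean `ohmicFloor_necessary_at_bathBond`).  Its natural POINTWISE supplier `DeficitUpperTail`
(`1 − θ_N(s) ≤ C/√s` on `[1, cN²]`) is VERBATIM card A's `C⁺` (`Ideas/bath-bond-deficit-integral.md`, "(S) ⟸ the N-uniform
UPPER tail") and VERBATIM the hinge statement the sibling line `contact-kolmogorov-triad` proves from its three N-uniform
estimates (`deficitUpperTail_of_triad`); the bridge `deficitCesaroEW_of_upperTail` is PROVED here from the LANDED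
fixed-N facts `BoundaryKernelBasics` (b) `K_N` continuous, (c) `|K_N| ≤ 2T²` (stmt-12239, closed; initial stretch
`1 − θ_N(s) ≤ 1 + 2γs`, interval-integrability, `∫₁ᵗ ds/√s = 2√t − 2`) — so the two boundary lines are now COMPOSABLE
(the triad is a line for this stub) instead of parallel, and the escape deficit `E_N` with its `∫_{Ioi 0} K_N` junk trap
has left the composition.  Every other stub of this file is landed (p73996, p76468, p76666, p76677 + p91142 + p78474 +
p79908); the skeleton has exactly ONE `sorry`.

**ANATOMY OF THE OPEN STUB (lead c3 `prover-line-stmt-AtomisticToContinuum-9120-c3-0`, 2026-08-17; everything below is LANDED under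
`Theorems/BondHeatUncertaintySubdiffusiveBondHeat*.lean` and imported above; the stub set is UNCHANGED: one sorry).**  With
`W_N(t) = ∫₀ᵗ(1 − θ_N)`, `E_N = 1 − (γ/T²)∫_{(0,∞)}K_N`, `Tr_N(t) = ∫₀ᵗ(1 − θ_N − E_N) = W_N(t) − tE_N`:
* transfers INTO (S): contact `subdiffusiveBondHeat_of_deficitCesaroEW` (p96625), bulk `subdiffusiveBondHeat_of_openBlockDiffusion`
  (p137529, lead c2), floor ⊕ transient `subdiffusiveBondHeat_of_ohmicFloor_transientEW` / `…_of_escapeLaw_transientEW` (p138777: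
  `E_N ≤ C₁/N` ∧ `Tr_N ≤ C₂√t on [1,cN²]` ⟹ stub ⟹ (S); the floor is dischargeable from `EscapeLaw` 12234 or from 12235 ∧ 12236);
* NECESSITY, kernel-checked on the real objects: `transientEW_of_deficitCesaroEW` (p139455: stub ⟹ `Tr_N ≤ C√t` on the window, because
  `E_N ≥ 0`) and `ohmicFloor_of_deficitCesaroEW_of_nonnegTransient` (p139587: stub ∧ `Tr_N ≥ 0` ⟹ `E_N ≤ (C/√c)/N`) — the
  crux-strategist's (D1) `(S)|_{b=0} ≡ Ohm ⊕ EW-transient` (STRATEGY-CENSUS.md §Decomposition) with both directions proved modulo the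
  sign of `Tr_N` (physically `Tr_N ≥ 0`: the deficit relaxes to its floor from above; cf. `GriffithsLimitExchange.BoundaryDEP`);
* FREE `N`-uniform bounds (the ballistic ceiling the stub must improve to `√t`): `deficitCesaro_le_self` (p139202: `W_N(t) ≤ t`, all `N`,
  all `t ≥ 0`, from `∫₀ᵗ∫₀ˢK_N = ½E[(∫₀ᵗ(p₀²−T))²] ≥ 0`) and `bathBondHeatVar_le_linear` (p139202: `∃B ∀N ≥ 2 ∀t ≥ 1, V_N(0,t) ≤ Bt` — the
  linear ceiling of the CRUX functional at the bath bond at ALL times, no light-cone restriction);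
* de-junking of the escape deficit: `escapeDeficit_nonneg` (p139455), `escapeDeficit_le_one` / `escapeDeficit_mem_Icc` (p139693):
  `0 ≤ E_N ≤ 1` for `N ≥ 2`, unconditionally (`0 ≤ (γ/T²)∫₀^∞K_N ≤ 1`).
So the gap between what is proved (`W_N ≤ t`) and what is asked (`W_N ≤ C√t` up to `cN²`) is exactly the open `N`-uniform
dynamical content; numerics for it at N = 1024, 2048 (kit j022049 / j022138, `--workitem` 9120) are commissioned by lead c3.

History.  Lead prover's skeleton (reshaped from the crux-plan skeleton of the same name, round 1, triage r1-1:
pass; lead `prover-line-stmt-AtomisticToContinuum-9120-lean-0`, 2026-08-16). The crux (S) asks, for the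
pinned anharmonic chain `P = pinnedChain ω₂ lam β γ` (all parameters `> 0`) with both Langevin baths at
temperature `T > 0`, for an `N`-uniform Edwards–Wilkinson bound `V_N(b,t) ≤ A √t` on the equilibrium
BOND-HEAT VARIANCE `V_N(b,t) = 2∫₀ᵗ (t-s) C_N(b,s) ds` (`C_N(b,s) = ∫ j_b · (P_s j_b) dμ_T`) of ONE bond `b`
of the prover's choice, for `1 ≤ t ≤ c N²`, `N ≥ N₀`.

**The line.** Take the bath bond `b = 0`. Energy balance at site `0`,
`d e₀ = -j₀ dt + dQ^L` with `e₀ = p₀²/2 + U(q₀) + ½ V(q₁ - q₀)` and the left-bath heat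
`dQ^L = γ (T - p₀²) dt + √(2γT) p₀ dW`, gives pathwise `∫₀ᵗ j₀ = Q^L_t - Δe₀`; the EXACT equilibrium identity
`Var_eq(Q^L_t) = 2γT² ∫₀ᵗ (1 - θ_N(s)) ds`, `θ_N(t) = (γ/T²) ∫₀ᵗ K_N`, `K_N(u) = ⟨p₀² - T, P_u(p₀² - T)⟩_{μ_T}`
(VERBATIM the objects of route `BoundaryEscapeDeficit`) converts (S) at `b = 0` into a bound on the
once-integrated ESCAPE-DEFICIT CURVE: `V_N(0,t) ≤ 4γT² ∫₀ᵗ (1 - θ_N) + 8 E_{μ_T}[e₀²]`, and the deficit curve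
splits EXACTLY into its Ohmic floor and its relaxation transient, `1 - θ_N(s) = E_N + (γ/T²) ∫_s^∞ K_N`.

**Reshape (lead, L1).** The registered stubs are now stated over TREE VOCABULARY ONLY (no local `def` in a
stub signature), so that each can be landed verbatim from a `Theorems/` file that imports only the two route
modules; the local `def`s below are abbreviations used by the sorry-free composition, bridged to the stubs by
`dif_pos` unfolding. The static stub of the plan (`E_{μ_T}[e₀²] ≤ σ²` uniformly in `N`) is split into its two
honest halves — the exact Gaussian momentum moment and the uniform one-site POSITION moments of the
one-dimensional Gibbs state — and their composition `siteEnergyMoment_le_of_moments` is proved here.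

**Stubs** (sorried, registered; RESHAPED 2026-08-16 by the re-seated lead: `stub_bathBondReduction` is now derived
from (H2) `stub_kernelDetailedBalance`, (H3) `stub_siteEnergyDynkin`, (H4) `stub_siteEnergyCurrentCovariance` via the
landed conditional `stub_bathBondReduction_of_kernelFacts`; both static stubs are landed):
* `stub_bathBondReduction` — FIXED `N ≥ 2`, every `t ≥ 0`: `V_N(0,t) ≤ 4γT² ∫₀ᵗ (1 - θ_N) + 8 E_{μ_T}[e₀²]`;
  size L–XL (kernel-level variance calculus for the constructed Markov kernels: Gibbs invariance
  `μ_T P_t = μ_T` = `BoundaryEscapeDeficit.BoundaryKernelBasics` (a), Markov property, Dynkin for polynomial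
  observables, `Θ`-reversibility at `T_L = T_R`).
* `stub_gibbsMomentumFourthMoment` — STATICS, exact: `p₀` is `N(0,T)` under `μ_T^N`, so `∫ p₀⁴ dμ_T^N ≤ 3T²`
  (with integrability), every `N ≥ 1`; size M (Fubini on `(Fin N → ℝ) × (Fin N → ℝ)`, Gaussian moments).
* `stub_gibbsPositionEighthMoment` — STATICS, `N`-uniform: `∫ q₀⁸ dμ_T^N, ∫ q₁⁸ dμ_T^N ≤ C` for all `N ≥ 2`
  (with integrability); size L. Route: every one-site marginal of the 1-D Gibbs state with EVEN CONVEX `U, V`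
  is `e^{-U/T} ×` (a symmetric unimodal factor) — Wintner: the convolution of two even functions
  non-increasing on `[0,∞)` is again such, applied along the transfer recursion
  `h_n = e^{-U/T} · (e^{-V/T} * h_{n-1})` — so by Chebyshev's covariance inequality (`a^{2k}` symmetric
  increasing vs. the symmetric unimodal factor, under the even measure `e^{-U/T} da`)
  `E_N[q_i^{2k}] ≤ ∫ a^{2k} e^{-U(a)/T} da / ∫ e^{-U/T}` uniformly in `N` and `i`.
* `stub_deficitCesaroEW` — THE ONE OPEN STUB (`N`-UNIFORM, size XL = open-problem calibre, held by the lead):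
  `∃ C c > 0, N₀ : ∀ N ≥ N₀, ∀ t ∈ [1, cN²], ∫₀ᵗ (1 − θ_N(s)) ds ≤ C √t` — the Cesàro EW bound of the escape-deficit
  curve = the EW ¼-law of the bath heat `W_N(t) = Var_eq(Q^L_t)/(2γT²) ≤ C√t` up to the Thouless time.  It is exactly
  what the two merged stubs supplied jointly (`∫₀ᵗ(1−θ_N) = ∫₀ᵗ(1−θ_N−E_N) + tE_N ≤ C₂√t + C₁t/N`) and it contains, if
  `1 − θ_N ≥ E_N` (nonnegative transient), the Ohm upper bound `E_N ≤ C/(√c N)` at `t = cN²` (barrier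
  `HasBoundedResponse` met head-on, as the card declares).  Calibration (Disproof.lean §4–§5, exact): FALSE at the
  harmonic member (`1 − θ_N` plateaus at `0.148`, then `E_N = 1/8`, so `W_N(t) ≥ t/8`), as it must be — anharmonicity is
  load-bearing; numerically supported for `pinnedChain 1 1 1 1`, `T = 1` (MD j007947: `W/√t` at `t = N²/16` = 4.4, 5.8,
  7.0 for N = 128, 256, 512, saturating towards `w + √c·N E_N ≈ 7`).  Pointwise supplier `DeficitUpperTail` bridged by
  `deficitCesaroEW_of_upperTail`.  No N-uniform supplier of either exists in tree or print (BLR2000 §6.3).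

Composition (sorry-free): `siteEnergyMoment_le_of_moments` (the two static stubs ⇒ `E[e₀²] ≤ 3T²/2 + …`),
`one_sub_stepResponse_le` / `continuous_stepResponse` (fixed N, from the landed `BoundaryKernelBasics`),
`deficitIntegral_le_of_upperTail` / `deficitCesaroEW_of_upperTail` (pointwise tail ⇒ Cesàro bound
`∫₀ᵗ(1−θ_N) ≤ (1 + 2γ + 2 max(C,0))√t` on the window — the bridge for pointwise suppliers), `bondHeatVar_le_of_parts`,
and `SubdiffusiveBondHeat_of`, which concludes the crux BY NAME (witness `b = 0`; the crux's `let V` is `bondHeatVar`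
definitionally) from `stub_deficitCesaroEW` and the landed stubs.

Disproof.lean (v2.1, read 2026-08-16T10:20Z): verdict RESISTS; `ohmicFloor_necessary_at_bathBond` (any `b = 0` line must
carry the Ohm upper bound — `stub_deficitCesaroEW` does at `t = cN²`, given a nonnegative transient); window tightness `Negative/WindowThreshold`
(p72842) — the window `cN²` of the stub is forced; calibration honoured above; no `-- Targets` entry kills a live stub.
-/

noncomputable section

open MeasureTheory Set Filter Topology

namespace Summit.AtomisticToContinuum.FouriersLaw.Cruxes.SubdiffusiveBondHeat.BathBondDeficitIntegral

open Literature.MathematicalPhysics.KineticTheory.HeatConduction (pinnedChain PhaseSpace)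
open Summit.AtomisticToContinuum.FouriersLaw.Theses.BondHeatUncertainty (SubdiffusiveBondHeat BoundedResponse)
open Summit.AtomisticToContinuum.FouriersLaw.Theses.BoundaryEscapeDeficit (EscapeLaw HalfChainTailLaw
  DiffusiveCrossover)

/-! ## The objects (verbatim the `let`s of the crux and of route `BoundaryEscapeDeficit`) -/

/-- `C_N(b,s) = ∫ j_b(z) · (P_s j_b)(z) dμ_T^N(z)`: the equilibrium autocorrelation of the energy current through
bond `(b, b+1)` of the `N`-site chain with both baths at `T` (constructed kernels; `0` if `b ≥ N`). Verbatim the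
`let C` of `BondHeatUncertainty.SubdiffusiveBondHeat`. -/
def bondCorr (ω₂ lam β γ T : ℝ) (N b : ℕ) (s : ℝ) : ℝ :=
  if h : b < N then
    ∫ z, (pinnedChain ω₂ lam β γ).bondCurrent N ⟨b, h⟩ z *
        (∫ y, (pinnedChain ω₂ lam β γ).bondCurrent N ⟨b, h⟩ y
          ∂((pinnedChain ω₂ lam β γ).transitionKernel N T T s.toNNReal z))
      ∂((pinnedChain ω₂ lam β γ).gibbsMeasure N T)
  else 0

/-- `V_N(b,t) = 2 ∫₀ᵗ (t - s) C_N(b,s) ds`: the equilibrium variance of the heat `Q_t^{(b)} = ∫₀ᵗ j_b` through bond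
`(b, b+1)`. Verbatim the `let V` of the crux. -/
def bondHeatVar (ω₂ lam β γ T : ℝ) (N b : ℕ) (t : ℝ) : ℝ :=
  2 * ∫ s in (0 : ℝ)..t, (t - s) * bondCorr ω₂ lam β γ T N b s

/-- `K_N(u) = ∫ (p₀² - T) · P_u(p₀² - T) dμ_T^N`: the boundary kinetic-temperature autocorrelation. Verbatim the
`let K` of route `BoundaryEscapeDeficit` (`HalfChainTailLaw`, `DiffusiveCrossover`, `ResponseIdentity`, …). -/
def kinCorr (ω₂ lam β γ T : ℝ) (N : ℕ) (u : ℝ) : ℝ :=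
  if h : 0 < N then
    ∫ z, ((z.2 ⟨0, h⟩) ^ 2 - T) *
        (∫ y, ((y.2 ⟨0, h⟩) ^ 2 - T) ∂((pinnedChain ω₂ lam β γ).transitionKernel N T T u.toNNReal z))
      ∂((pinnedChain ω₂ lam β γ).gibbsMeasure N T)
  else 0

/-- `θ_N(t) = (γ/T²) ∫₀ᵗ K_N(u) du`: the normalised step response of `⟨p₀²⟩` to the left bath temperature
(`1 - θ_N` = the escape-deficit curve). Verbatim the `let θ` of route `BoundaryEscapeDeficit`. -/
def stepResponse (ω₂ lam β γ T : ℝ) (N : ℕ) (t : ℝ) : ℝ :=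
  γ / T ^ 2 * ∫ u in (0 : ℝ)..t, kinCorr ω₂ lam β γ T N u

/-- `∫₀ᵗ (1 - θ_N(s)) ds` — by the bath-heat variance identity this is `Var_eq(Q^L_t) / (2γT²)`. -/
def deficitIntegral (ω₂ lam β γ T : ℝ) (N : ℕ) (t : ℝ) : ℝ :=
  ∫ s in (0 : ℝ)..t, (1 - stepResponse ω₂ lam β γ T N s)

/-- The local energy at the bath site, `e₀ = p₀²/2 + U(q₀) + ½ V(q₁ - q₀)` (`0` on chains with fewer than two
sites): `d e₀/dt |_Hamiltonian = -j₀` for the tree's symmetric bond current `j₀ = -½ (p₀ + p₁) V'(q₁ - q₀)`. -/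
def siteEnergy₀ (ω₂ lam β γ : ℝ) (N : ℕ) (z : PhaseSpace N) : ℝ :=
  if h : 1 < N then
    (z.2 ⟨0, Nat.zero_lt_of_lt h⟩) ^ 2 / 2 + (pinnedChain ω₂ lam β γ).U (z.1 ⟨0, Nat.zero_lt_of_lt h⟩) +
      (pinnedChain ω₂ lam β γ).V (z.1 ⟨1, h⟩ - z.1 ⟨0, Nat.zero_lt_of_lt h⟩) / 2
  else 0

/-- `E_{μ_T^N}[e₀²]`: second moment of the bath-site energy under the Gibbs measure. -/
def siteEnergyMoment (ω₂ lam β γ T : ℝ) (N : ℕ) : ℝ :=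
  ∫ z, (siteEnergy₀ ω₂ lam β γ N z) ^ 2 ∂((pinnedChain ω₂ lam β γ).gibbsMeasure N T)

/-! ## Def-level statements (abbreviations; the REGISTERED stubs below spell them out) -/

/-- `V_N(0,t) ≤ 4γT² ∫₀ᵗ (1 - θ_N(s)) ds + 8 E_{μ_T}[e₀²]` for `N ≥ 2`, `t ≥ 0`. -/
def BathBondReduction : Prop :=
  ∀ ω₂ lam β γ : ℝ, 0 < ω₂ → 0 < lam → 0 < β → 0 < γ → ∀ T : ℝ, 0 < T →
    ∀ N : ℕ, 2 ≤ N → ∀ t : ℝ, 0 ≤ t →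
      bondHeatVar ω₂ lam β γ T N 0 t ≤
        4 * γ * T ^ 2 * deficitIntegral ω₂ lam β γ T N t + 8 * siteEnergyMoment ω₂ lam β γ T N

/-- `E_{μ_T^N}[e₀²] ≤ σ²` for all `N ≥ 2`. -/
def LocalEnergyMoment : Prop :=
  ∀ ω₂ lam β γ : ℝ, 0 < ω₂ → 0 < lam → 0 < β → 0 < γ → ∀ T : ℝ, 0 < T →
    ∃ σ2 : ℝ, ∀ N : ℕ, 2 ≤ N → siteEnergyMoment ω₂ lam β γ T N ≤ σ2

/-- **`DeficitUpperTail`** (card A's `C⁺`; VERBATIM the hinge `DeficitUpperTail` of line `contact-kolmogorov-triad` up to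
the name of the deficit curve): `∃ C, c > 0, N₀ : ∀ N ≥ N₀, ∀ s ∈ [1, cN²], 1 − θ_N(s) ≤ C/√s` — the upper
Edwards–Wilkinson tail of the boundary escape-deficit curve up to the Thouless time. -/
def DeficitUpperTail : Prop :=
  ∀ ω₂ lam β γ : ℝ, 0 < ω₂ → 0 < lam → 0 < β → 0 < γ → ∀ T : ℝ, 0 < T →
    ∃ C c : ℝ, 0 < c ∧ ∃ N₀ : ℕ, ∀ N : ℕ, N₀ ≤ N → ∀ s : ℝ, 1 ≤ s → s ≤ c * (N : ℝ) ^ 2 →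
      1 - stepResponse ω₂ lam β γ T N s ≤ C / Real.sqrt s

/-- **`DeficitCesaroEW`** — the WEAKEST statement the composition consumes (the REGISTERED open stub is its spelled-out
form `stub_deficitCesaroEW`): `∃ C, c > 0, N₀ : ∀ N ≥ N₀, ∀ t ∈ [1, cN²], ∫₀ᵗ (1 − θ_N(s)) ds ≤ C √t`, i.e. — by the
landed bath-heat identity `Var_eq(Q^L_t) = 2γT² ∫₀ᵗ(1 − θ_N)` — the Edwards–Wilkinson ¼-law of the heat exchanged
with ONE reservoir at equilibrium up to the Thouless time.  `DeficitUpperTail → DeficitCesaroEW`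
(`deficitCesaroEW_of_upperTail`, proved below from the landed `BoundaryKernelBasics`); conversely (S) at `b = 0` gives it
back (`Var Q^L ≤ 2 Var ∫j₀ + 8E[e₀²]`, same fixed-N technology), so along this line the crux at the bath bond IS this
statement. -/
def DeficitCesaroEW : Prop :=
  ∀ ω₂ lam β γ : ℝ, 0 < ω₂ → 0 < lam → 0 < β → 0 < γ → ∀ T : ℝ, 0 < T →
    ∃ C c : ℝ, 0 < c ∧ ∃ N₀ : ℕ, ∀ N : ℕ, N₀ ≤ N → ∀ t : ℝ, 1 ≤ t → t ≤ c * (N : ℝ) ^ 2 →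
      deficitIntegral ω₂ lam β γ T N t ≤ C * Real.sqrt t

/-! ## Registered stubs (signatures over tree vocabulary only) -/

/-- **Stub (H2)** (fixed `N ≥ 2`, size XL — the line's fixed-`N` blocker after the reshape of 2026-08-16): DETAILED BALANCE
of the constructed kernels under momentum reversal `Θ(q,p) = (q,-p)`, weak `L²(μ_T)` form:
`∫ f · (P_s h) dμ_T = ∫ (h∘Θ) · P_s (f∘Θ) dμ_T` for measurable `f, h` with `f², h² ∈ L¹(μ_T)` — the generalised
detailed balance `L† = ΘLΘ` of the equilibrium Langevin dynamics (time reversal of the stationary kernel process is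
the momentum-flipped process). Route: Doob `e^{-H/T}`-transform of the Lebesgue duality
`dx P_t(x,dy) = e^{2γt} dy P̂_t(y,dx)` (`LangevinChainReversal`) using `P̂_t e^{-H/T} = e^{-2γt}e^{-H/T}`
(`…KernelGibbsC`), then identification of the transformed reversed semigroup with the flipped forward one (common
generator `ΘLΘ`; needs a Girsanov-type change of drift `2γ 1_B p` in the noise directions, or uniqueness for the
Kolmogorov equation). Hypothesis (H2) of the landed conditional reduction `stub_bathBondReduction_of_kernelFacts`. PROGRESS (lead, landed p78227
`…KernelDoobTransform`): the Doob transform `P̃_t = e^{2γt}ρ⁻¹P̂_t(ρ·)` satisfies Dynkin on `C²_c` with the flipped generator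
`(L(f∘Θ))∘Θ` — the SAME Dynkin data as the flipped forward semigroup; (H2) is thereby EXACTLY the uniqueness of Markov
semigroups with a common Dynkin identity on `C²_c`. CLOSED 2026-08-16 (lead + wave 3) by the RESOLVENT route: density of
`(λ - L)C_c^∞` in `L²(μ_T)` (Hörmander regularity `exists_contDiff_ae_eq_of_weak_resolvent` + cutoff energy estimate), the
resolvent identity, static flip-adjointness, Laplace-transform uniqueness and `L²` density — see `…KernelDetailedBalance*.lean`. -/
theorem stub_kernelDetailedBalance :
    ∀ ω₂ lam β γ : ℝ, 0 < ω₂ → 0 < lam → 0 < β → 0 < γ → ∀ T : ℝ, 0 < T → ∀ (N : ℕ) (hN : 1 < N),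
      ∀ (s : NNReal) (f h : PhaseSpace N → ℝ), Measurable f → Measurable h →
        Integrable (fun y => f y ^ 2) ((pinnedChain ω₂ lam β γ).gibbsMeasure N T) →
        Integrable (fun y => h y ^ 2) ((pinnedChain ω₂ lam β γ).gibbsMeasure N T) →
        ∫ y, f y * (∫ y', h y' ∂((pinnedChain ω₂ lam β γ).transitionKernel N T T s) y)
            ∂((pinnedChain ω₂ lam β γ).gibbsMeasure N T) =
          ∫ y, h (y.1, -y.2) * (∫ y', f (y'.1, -y'.2) ∂((pinnedChain ω₂ lam β γ).transitionKernel N T T s) y)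
            ∂((pinnedChain ω₂ lam β γ).gibbsMeasure N T) :=
  -- LANDED (lead, p91142; parts A–D p86837 p88014 p89621 p90748; sub-stubs p85606 p85496 p85280 p85679):
  -- Theorems/BondHeatUncertaintySubdiffusiveBondHeatKernelDetailedBalance.lean (resolvent route: Range(λ−L)C_c^∞ dense by
  -- hypoelliptic regularity + cutoff energy estimate; Laplace transform; L² density)
  Summit.AtomisticToContinuum.FouriersLaw.Theorems.SubdiffusiveBondHeat.stub_kernelDetailedBalance

/-- **Stub (H3)** (fixed `N ≥ 2`, size L): DYNKIN'S IDENTITY for the polynomially growing bath-site energy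
`e₀ = p₀²/2 + U(q₀) + ½V(q₁ - q₀)` along the constructed kernels: `P_r e₀(z) - e₀(z) = ∫₀ʳ P_s(L e₀)(z) ds` with
`L e₀ = γ(T - p₀²) - j₀` (pointwise generator identity `pinnedChain_generator_siteEnergy`, landed). The tree has Dynkin on
`C_c^∞` (`pinnedChain_dynkin`); the extension is the truncation `e₀ χ(H/R)` + exponential moments of `P_s(z,·)` (the
technique of `…KernelGibbsB/C`). Hypothesis (H3) of `stub_bathBondReduction_of_kernelFacts`. -/
theorem stub_siteEnergyDynkin :
    ∀ ω₂ lam β γ : ℝ, 0 < ω₂ → 0 < lam → 0 < β → 0 < γ → ∀ T : ℝ, 0 < T → ∀ (N : ℕ) (hN : 1 < N),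
      ∀ (r : NNReal) (z : PhaseSpace N),
        ∫ y, ((y.2 ⟨0, Nat.zero_lt_of_lt hN⟩) ^ 2 / 2 + (pinnedChain ω₂ lam β γ).U (y.1 ⟨0, Nat.zero_lt_of_lt hN⟩) +
              (pinnedChain ω₂ lam β γ).V (y.1 ⟨1, hN⟩ - y.1 ⟨0, Nat.zero_lt_of_lt hN⟩) / 2)
            ∂((pinnedChain ω₂ lam β γ).transitionKernel N T T r z) -
          ((z.2 ⟨0, Nat.zero_lt_of_lt hN⟩) ^ 2 / 2 + (pinnedChain ω₂ lam β γ).U (z.1 ⟨0, Nat.zero_lt_of_lt hN⟩) +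
            (pinnedChain ω₂ lam β γ).V (z.1 ⟨1, hN⟩ - z.1 ⟨0, Nat.zero_lt_of_lt hN⟩) / 2) =
        ∫ s in (0 : ℝ)..(r : ℝ), ∫ y, (γ * (T - (y.2 ⟨0, Nat.zero_lt_of_lt hN⟩) ^ 2) -
            (pinnedChain ω₂ lam β γ).bondCurrent N ⟨0, Nat.zero_lt_of_lt hN⟩ y)
          ∂((pinnedChain ω₂ lam β γ).transitionKernel N T T s.toNNReal z) :=
  -- LANDED (p78474): Theorems/BondHeatUncertaintySubdiffusiveBondHeatSiteEnergyDynkin.lean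
  Summit.AtomisticToContinuum.FouriersLaw.Theorems.SubdiffusiveBondHeat.stub_siteEnergyDynkin

/-- **Stub (H4)** (statics, size M): the static Gibbs inequality `∫ e₀ (j₀ - γ(T - p₀²)) dμ_T ≤ γT²` (true with
EQUALITY: `⟨e₀ j₀⟩ = 0` by momentum parity, `⟨F(q)(T - p₀²)⟩ = 0` by the Gaussian integration by parts
`⟨F(q) p₀²⟩ = T⟨F(q)⟩`, and `⟨(p₀²/2)(T - p₀²)⟩ = (T² - 3T²)/2 = -T²`). Hypothesis (H4) of
`stub_bathBondReduction_of_kernelFacts`. -/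
theorem stub_siteEnergyCurrentCovariance :
    ∀ ω₂ lam β γ : ℝ, 0 < ω₂ → 0 < lam → 0 < β → 0 < γ → ∀ T : ℝ, 0 < T → ∀ (N : ℕ) (hN : 1 < N),
      ∫ y, ((y.2 ⟨0, Nat.zero_lt_of_lt hN⟩) ^ 2 / 2 + (pinnedChain ω₂ lam β γ).U (y.1 ⟨0, Nat.zero_lt_of_lt hN⟩) +
            (pinnedChain ω₂ lam β γ).V (y.1 ⟨1, hN⟩ - y.1 ⟨0, Nat.zero_lt_of_lt hN⟩) / 2) *
          ((pinnedChain ω₂ lam β γ).bondCurrent N ⟨0, Nat.zero_lt_of_lt hN⟩ y -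
            γ * (T - (y.2 ⟨0, Nat.zero_lt_of_lt hN⟩) ^ 2)) ∂((pinnedChain ω₂ lam β γ).gibbsMeasure N T) ≤
        γ * T ^ 2 :=
  -- LANDED (p79908): Theorems/BondHeatUncertaintySubdiffusiveBondHeatSiteEnergyCurrentCovariance.lean
  Summit.AtomisticToContinuum.FouriersLaw.Theorems.SubdiffusiveBondHeat.stub_siteEnergyCurrentCovariance

/-- **Bath-bond reduction** (fixed `N ≥ 2`; formerly `stub_bathBondReduction`, RESHAPED 2026-08-16): the inequality
`V_N(0,t) ≤ 4γT² ∫₀ᵗ (1 - (γ/T²)∫₀ˢ K_N) ds + 8 E_{μ_T^N}[e₀²]` for every `t ≥ 0`, now DERIVED from the three stubs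
(H2) `stub_kernelDetailedBalance`, (H3) `stub_siteEnergyDynkin`, (H4) `stub_siteEnergyCurrentCovariance` through the
landed conditional theorem `stub_bathBondReduction_of_kernelFacts` (p76677; Kundu–Dhar–Narayan argument run at the
kernel level, kernel Gibbs invariance consumed from `pinnedChain_gibbsMeasure_bind_transitionKernel`). -/
theorem stub_bathBondReduction :
    ∀ ω₂ lam β γ : ℝ, 0 < ω₂ → 0 < lam → 0 < β → 0 < γ → ∀ T : ℝ, 0 < T →
      ∀ (N : ℕ) (hN : 1 < N) (t : ℝ), 0 ≤ t →
        2 * (∫ s in (0 : ℝ)..t, (t - s) *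
            ∫ z, (pinnedChain ω₂ lam β γ).bondCurrent N ⟨0, Nat.zero_lt_of_lt hN⟩ z *
                (∫ y, (pinnedChain ω₂ lam β γ).bondCurrent N ⟨0, Nat.zero_lt_of_lt hN⟩ y
                  ∂((pinnedChain ω₂ lam β γ).transitionKernel N T T s.toNNReal z))
              ∂((pinnedChain ω₂ lam β γ).gibbsMeasure N T)) ≤
          4 * γ * T ^ 2 * (∫ s in (0 : ℝ)..t, (1 - γ / T ^ 2 * ∫ u in (0 : ℝ)..s,
              ∫ z, ((z.2 ⟨0, Nat.zero_lt_of_lt hN⟩) ^ 2 - T) *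
                  (∫ y, ((y.2 ⟨0, Nat.zero_lt_of_lt hN⟩) ^ 2 - T)
                    ∂((pinnedChain ω₂ lam β γ).transitionKernel N T T u.toNNReal z))
                ∂((pinnedChain ω₂ lam β γ).gibbsMeasure N T))) +
            8 * ∫ z, ((z.2 ⟨0, Nat.zero_lt_of_lt hN⟩) ^ 2 / 2 +
                (pinnedChain ω₂ lam β γ).U (z.1 ⟨0, Nat.zero_lt_of_lt hN⟩) +
                (pinnedChain ω₂ lam β γ).V (z.1 ⟨1, hN⟩ - z.1 ⟨0, Nat.zero_lt_of_lt hN⟩) / 2) ^ 2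
              ∂((pinnedChain ω₂ lam β γ).gibbsMeasure N T) :=
  fun ω₂ lam β γ hω hl hβ hγ T hT N hN t ht =>
    Summit.AtomisticToContinuum.FouriersLaw.Theorems.SubdiffusiveBondHeat.stub_bathBondReduction_of_kernelFacts
      ω₂ lam β γ hω hl hβ hγ T hT N hN
      (stub_kernelDetailedBalance ω₂ lam β γ hω hl hβ hγ T hT N hN)
      (stub_siteEnergyDynkin ω₂ lam β γ hω hl hβ hγ T hT N hN)
      (stub_siteEnergyCurrentCovariance ω₂ lam β γ hω hl hβ hγ T hT N hN) t ht

/-- **Stub** (statics, size M): the bath-site momentum is exactly Gaussian `N(0,T)` under the Gibbs state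
`μ_T^N = Z⁻¹ e^{-H/T} dq dp` (`H = ∑ p_i²/2 + Φ(q)`, product structure), so its fourth moment is `3T²`; stated as
integrability plus the bound `∫ p₀⁴ dμ_T^N ≤ 3T²`, for every `N ≥ 1` and `T > 0`. -/
theorem stub_gibbsMomentumFourthMoment :
    ∀ ω₂ lam β γ : ℝ, 0 < ω₂ → 0 < lam → 0 < β → 0 < γ → ∀ T : ℝ, 0 < T →
      ∀ (N : ℕ) (hN : 0 < N),
        Integrable (fun z : PhaseSpace N => (z.2 ⟨0, hN⟩) ^ 4) ((pinnedChain ω₂ lam β γ).gibbsMeasure N T) ∧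
        ∫ z, (z.2 ⟨0, hN⟩) ^ 4 ∂((pinnedChain ω₂ lam β γ).gibbsMeasure N T) ≤ 3 * T ^ 2 :=
  -- LANDED (p73996): Theorems/BondHeatUncertaintySubdiffusiveBondHeatGibbsMomentumFourthMoment.lean
  Summit.AtomisticToContinuum.FouriersLaw.Theorems.SubdiffusiveBondHeat.stub_gibbsMomentumFourthMoment

/-- **Stub** (statics, size L, `N`-uniform): uniform eighth moments of the positions at the two sites of the
bath bond under the Gibbs state of the pinned chain: there is `C` with `∫ q₀⁸ dμ_T^N ≤ C` and `∫ q₁⁸ dμ_T^N ≤ C`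
(with integrability) for every `N ≥ 2`. One-dimensional Gibbs state with even convex pinning
`U(q) = ω₂q²/2 + lam q⁴/4` and coupling `V(r) = r²/2 + βr⁴/4`: each one-site marginal is `e^{-U/T}` times a
symmetric unimodal factor (transfer recursion + Wintner's lemma), whence `E_N[q_i⁸] ≤ ∫ a⁸e^{-U(a)/T}da/∫e^{-U/T}`
by Chebyshev's covariance inequality. -/
theorem stub_gibbsPositionEighthMoment :
    ∀ ω₂ lam β γ : ℝ, 0 < ω₂ → 0 < lam → 0 < β → 0 < γ → ∀ T : ℝ, 0 < T →
      ∃ C : ℝ, ∀ (N : ℕ) (hN : 1 < N),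
        Integrable (fun z : PhaseSpace N => (z.1 ⟨0, Nat.zero_lt_of_lt hN⟩) ^ 8)
            ((pinnedChain ω₂ lam β γ).gibbsMeasure N T) ∧
        Integrable (fun z : PhaseSpace N => (z.1 ⟨1, hN⟩) ^ 8) ((pinnedChain ω₂ lam β γ).gibbsMeasure N T) ∧
        ∫ z, (z.1 ⟨0, Nat.zero_lt_of_lt hN⟩) ^ 8 ∂((pinnedChain ω₂ lam β γ).gibbsMeasure N T) ≤ C ∧
        ∫ z, (z.1 ⟨1, hN⟩) ^ 8 ∂((pinnedChain ω₂ lam β γ).gibbsMeasure N T) ≤ C :=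
  -- LANDED (p76468): Theorems/BondHeatUncertaintySubdiffusiveBondHeatGibbsPositionEighthMoment.lean
  Summit.AtomisticToContinuum.FouriersLaw.Theorems.SubdiffusiveBondHeat.stub_gibbsPositionEighthMoment

/-- **Stub — THE OPEN ONE** (`N`-uniform, size XL = open-problem calibre, held by the lead; RESHAPE 2026-08-16 merging
`stub_ohmicFloor` and `stub_transientEW`).  PHYSICAL FORM: the upper Edwards–Wilkinson tail of the boundary
escape-deficit curve up to the Thouless time, `1 − θ_N(s) ≤ C/√s` for `1 ≤ s ≤ cN²`, `N ≥ N₀` (`DeficitUpperTail`),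
with `θ_N(s) = (γ/T²)∫₀ˢ K_N` and `K_N` VERBATIM the `let K`, `let θ` of route `BoundaryEscapeDeficit`
(`HalfChainTailLaw`, stmt-12235, is its `M → ∞` shadow: upper half, `∀ᶠ M` non-quantitative).  Card A's `C⁺`; the
sibling line `contact-kolmogorov-triad` derives exactly that statement from its stubs (`deficitUpperTail_of_triad`).
Reading: `1 − θ_N(s)` = fraction of a step of the left bath temperature
not yet accommodated by `⟨p₀²⟩` after time `s` = normalised bath-heat variance growth rate
`(d/dt) Var_eq(Q^L_t) / (2γT²)`; the claim is the diffusive (first-return, `s^{-1/2}`) decay of that rate, uniformly in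
the length, until the Thouless time where it meets its Ohmic floor `E_N ≍ 1/N ≤ C/(√c N)`.  FALSE at the harmonic
member (plateau `0.148`, Disproof.lean §4) — anharmonicity load-bearing, as for (S).

REGISTERED FORM (the weakest the composition consumes): the once-integrated (Cesàro) version
`∫₀ᵗ (1 − θ_N(s)) ds ≤ C √t` for `1 ≤ t ≤ cN²`, `N ≥ N₀` = `DeficitCesaroEW` spelled out = the EW ¼-law of the bath heat
`Var_eq(Q^L_t) ≤ 2γT²C √t` up to the Thouless time.  Suppliers: the pointwise tail `DeficitUpperTail`
(`deficitCesaroEW_of_upperTail` below; hence the triad line), an Abel-mean bound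
`∫₀^∞ e^{-νu}K_N(u)du ≥ (T²/γ)(1 − C'√ν)` on `ν ∈ [1/(cN²), 1]` together with the sign `θ_N ≤ 1` (card A's SUP
variational engine), or any direct EW bound on the reservoir-heat variance. -/
theorem stub_deficitCesaroEW :
    ∀ ω₂ lam β γ : ℝ, 0 < ω₂ → 0 < lam → 0 < β → 0 < γ → ∀ T : ℝ, 0 < T →
      ∃ C c : ℝ, 0 < c ∧ ∃ N₀ : ℕ, ∀ N : ℕ, N₀ ≤ N → ∀ t : ℝ, 1 ≤ t → t ≤ c * (N : ℝ) ^ 2 →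
        (∫ s in (0 : ℝ)..t,
          (1 - γ / T ^ 2 * (∫ u in (0 : ℝ)..s,
            if h : 0 < N then
              ∫ z, ((z.2 ⟨0, h⟩) ^ 2 - T) *
                  (∫ y, ((y.2 ⟨0, h⟩) ^ 2 - T)
                    ∂((pinnedChain ω₂ lam β γ).transitionKernel N T T u.toNNReal z))
                ∂((pinnedChain ω₂ lam β γ).gibbsMeasure N T)
            else 0))) ≤ C * Real.sqrt t := by
  sorry

/-! ## Bridges: the registered stubs give the def-level statements -/

/-- `stub_bathBondReduction` in def form. -/
theorem bathBondReduction_holds : BathBondReduction := by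
  intro ω₂ lam β γ hω hl hβ hγ T hT N hN t ht
  have h1 : 1 < N := hN
  have h0 : 0 < N := Nat.zero_lt_of_lt h1
  have h := stub_bathBondReduction ω₂ lam β γ hω hl hβ hγ T hT N h1 t ht
  simp only [bondHeatVar, bondCorr, deficitIntegral, stepResponse, kinCorr, siteEnergyMoment, siteEnergy₀,
    dif_pos h0, dif_pos h1]
  exact h

/-- `stub_deficitCesaroEW` in def form. -/
theorem deficitCesaroEW_holds : DeficitCesaroEW := by
  intro ω₂ lam β γ hω hl hβ hγ T hT
  obtain ⟨C, c, hc, N₀, h⟩ := stub_deficitCesaroEW ω₂ lam β γ hω hl hβ hγ T hT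
  refine ⟨C, c, hc, N₀, fun N hN t ht htc => ?_⟩
  have h' := h N hN t ht htc
  simp only [deficitIntegral, stepResponse, kinCorr]
  exact h'

/-! ## Fixed-N control of the deficit curve (from the landed `BoundaryKernelBasics`, stmt-12239) -/

section FixedN

variable {ω₂ lam β γ T : ℝ} (hω : 0 < ω₂) (hl : 0 < lam) (hβ : 0 < β) (hγ : 0 < γ) (hT : 0 < T) {N : ℕ}
  (hN : 0 < N)
include hω hl hβ hγ hT hN

/-- `K_N` is continuous (BoundaryKernelBasics (b), landed). -/
theorem continuous_kinCorr : Continuous (kinCorr ω₂ lam β γ T N) := by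
  obtain ⟨-, hKc, -, -, -⟩ :=
    Summit.AtomisticToContinuum.FouriersLaw.Theorems.SubdiffusiveBondHeat.boundaryKernelBasics_proof
      ω₂ lam β γ hω hl hβ hγ T hT N hN
  have e : kinCorr ω₂ lam β γ T N = fun u => kinCorr ω₂ lam β γ T N u := rfl
  rw [e]
  simp only [kinCorr]
  exact hKc

/-- `|K_N(u)| ≤ 2T²` (BoundaryKernelBasics (c), landed). -/
theorem abs_kinCorr_le (u : ℝ) : |kinCorr ω₂ lam β γ T N u| ≤ 2 * T ^ 2 := by
  obtain ⟨-, -, hKb, -, -⟩ :=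
    Summit.AtomisticToContinuum.FouriersLaw.Theorems.SubdiffusiveBondHeat.boundaryKernelBasics_proof
      ω₂ lam β γ hω hl hβ hγ T hT N hN
  have h := hKb u
  simp only [kinCorr]
  exact h

/-- `θ_N` is continuous (primitive of a continuous function). -/
theorem continuous_stepResponse : Continuous (stepResponse ω₂ lam β γ T N) := by
  have hK := continuous_kinCorr hω hl hβ hγ hT hN
  have hprim : Continuous fun s => ∫ u in (0 : ℝ)..s, kinCorr ω₂ lam β γ T N u :=
    intervalIntegral.continuous_primitive (fun a b => hK.intervalIntegrable a b) 0
  have e : stepResponse ω₂ lam β γ T N = fun s => γ / T ^ 2 * ∫ u in (0 : ℝ)..s, kinCorr ω₂ lam β γ T N u := rfl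
  rw [e]
  exact continuous_const.mul hprim

/-- The deficit curve is bounded on initial stretches: `1 − θ_N(s) ≤ 1 + 2γ s` for `s ≥ 0` (from `|K_N| ≤ 2T²`). -/
theorem one_sub_stepResponse_le {s : ℝ} (hs : 0 ≤ s) : 1 - stepResponse ω₂ lam β γ T N s ≤ 1 + 2 * γ * s := by
  have hK := continuous_kinCorr hω hl hβ hγ hT hN
  have hb : ∀ x ∈ Set.uIoc (0 : ℝ) s, ‖kinCorr ω₂ lam β γ T N x‖ ≤ 2 * T ^ 2 := fun x _ => by
    rw [Real.norm_eq_abs]; exact abs_kinCorr_le hω hl hβ hγ hT hN x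
  have hI := intervalIntegral.norm_integral_le_of_norm_le_const hb
  rw [Real.norm_eq_abs, sub_zero, abs_of_nonneg hs] at hI
  have hT2 : 0 < T ^ 2 := by positivity
  have hγT : 0 ≤ γ / T ^ 2 := div_nonneg hγ.le hT2.le
  have h1 : |stepResponse ω₂ lam β γ T N s| ≤ 2 * γ * s := by
    unfold stepResponse
    rw [abs_mul, abs_of_nonneg hγT]
    calc γ / T ^ 2 * |∫ u in (0 : ℝ)..s, kinCorr ω₂ lam β γ T N u| ≤ γ / T ^ 2 * (2 * T ^ 2 * s) :=
          mul_le_mul_of_nonneg_left hI hγT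
      _ = 2 * γ * s := by field_simp
  have h2 := neg_abs_le (stepResponse ω₂ lam β γ T N s)
  linarith

end FixedN

/-! ## Statics: the two moment stubs give the uniform bath-site energy moment -/

/-- Square of a sum of four reals. -/
theorem sq_add_four_le (w x y z : ℝ) : (w + x + y + z) ^ 2 ≤ 4 * (w ^ 2 + x ^ 2 + y ^ 2 + z ^ 2) := by
  have key : 4 * (w ^ 2 + x ^ 2 + y ^ 2 + z ^ 2) - (w + x + y + z) ^ 2 =
      (w - x) ^ 2 + (w - y) ^ 2 + (w - z) ^ 2 + (x - y) ^ 2 + (x - z) ^ 2 + (y - z) ^ 2 := by ring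
  have hnn : 0 ≤ (w - x) ^ 2 + (w - y) ^ 2 + (w - z) ^ 2 + (x - y) ^ 2 + (x - z) ^ 2 + (y - z) ^ 2 := by
    positivity
  linarith

/-- `r⁴ ≤ 8a⁴ + 8b⁴` for `r = b - a`. -/
theorem sub_pow_four_le (a b : ℝ) : (b - a) ^ 4 ≤ 8 * a ^ 4 + 8 * b ^ 4 := by
  have hr2 : (b - a) ^ 2 ≤ 2 * a ^ 2 + 2 * b ^ 2 := by nlinarith [sq_nonneg (a + b)]
  have h1 : ((b - a) ^ 2) ^ 2 ≤ (2 * a ^ 2 + 2 * b ^ 2) ^ 2 := pow_le_pow_left₀ (sq_nonneg _) hr2 2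
  have e1 : (b - a) ^ 4 = ((b - a) ^ 2) ^ 2 := by ring
  have e2 : (2 * a ^ 2 + 2 * b ^ 2) ^ 2 = 8 * a ^ 4 + 8 * b ^ 4 - 4 * (a ^ 2 - b ^ 2) ^ 2 := by ring
  have h3 : 0 ≤ (a ^ 2 - b ^ 2) ^ 2 := sq_nonneg _
  rw [e1]; rw [e2] at h1; linarith

/-- `r⁸ ≤ 128a⁸ + 128b⁸` for `r = b - a`. -/
theorem sub_pow_eight_le (a b : ℝ) : (b - a) ^ 8 ≤ 128 * a ^ 8 + 128 * b ^ 8 := by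
  have hr4 := sub_pow_four_le a b
  have hr4n : 0 ≤ (b - a) ^ 4 := by positivity
  have h1 : ((b - a) ^ 4) ^ 2 ≤ (8 * a ^ 4 + 8 * b ^ 4) ^ 2 := pow_le_pow_left₀ hr4n hr4 2
  have e1 : (b - a) ^ 8 = ((b - a) ^ 4) ^ 2 := by ring
  have e2 : (8 * a ^ 4 + 8 * b ^ 4) ^ 2 = 128 * a ^ 8 + 128 * b ^ 8 - 64 * (a ^ 4 - b ^ 4) ^ 2 := by ring
  have h3 : 0 ≤ (a ^ 4 - b ^ 4) ^ 2 := sq_nonneg _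
  rw [e1]; rw [e2] at h1; linarith

/-- `a⁴ ≤ 1 + a⁸`. -/
theorem pow_four_le_one_add_pow_eight (a : ℝ) : a ^ 4 ≤ 1 + a ^ 8 := by
  have h : 0 ≤ (a ^ 4 - 1) ^ 2 := sq_nonneg _
  have e : (a ^ 4 - 1) ^ 2 = a ^ 8 - 2 * a ^ 4 + 1 := by ring
  have h4 : 0 ≤ a ^ 4 := by positivity
  rw [e] at h; linarith

/-- Pointwise: `(U(a) + V(b - a)/2)² ≤ A · (1 + a⁸ + b⁸)` for the pinned-chain potentials, with
`A = A(ω₂, lam, β) = 4(ω₂² + lam²) + 2¹⁰(1 + β²)` (generous). -/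
theorem potentialEnergy_sq_le (ω₂ lam β γ a b : ℝ) :
    ((pinnedChain ω₂ lam β γ).U a + (pinnedChain ω₂ lam β γ).V (b - a) / 2) ^ 2 ≤
      (4 * (ω₂ ^ 2 + lam ^ 2) + 2 ^ 10 * (1 + β ^ 2)) * (1 + a ^ 8 + b ^ 8) := by
  have hU : (pinnedChain ω₂ lam β γ).U a = ω₂ * a ^ 2 / 2 + lam * a ^ 4 / 4 := rfl
  have hV : (pinnedChain ω₂ lam β γ).V (b - a) = (b - a) ^ 2 / 2 + β * (b - a) ^ 4 / 4 := rfl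
  rw [hU, hV]
  have ha8n : 0 ≤ a ^ 8 := by positivity
  have hb8n : 0 ≤ b ^ 8 := by positivity
  have ha4 := pow_four_le_one_add_pow_eight a
  have hb4 := pow_four_le_one_add_pow_eight b
  have hr4 := sub_pow_four_le a b
  have hr8 := sub_pow_eight_le a b
  have hβ2 : 0 ≤ β ^ 2 := sq_nonneg β
  have hω2 : 0 ≤ ω₂ ^ 2 := sq_nonneg ω₂
  have hl2 : 0 ≤ lam ^ 2 := sq_nonneg lam
  -- `M = 1 + a⁸ + b⁸`
  have hM0 : 0 ≤ 1 + a ^ 8 + b ^ 8 := by positivity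
  -- the four squares
  have t1 : (ω₂ * a ^ 2 / 2) ^ 2 ≤ ω₂ ^ 2 * (1 + a ^ 8 + b ^ 8) := by
    have e : (ω₂ * a ^ 2 / 2) ^ 2 = ω₂ ^ 2 * (a ^ 4 / 4) := by ring
    rw [e]
    exact mul_le_mul_of_nonneg_left (by linarith) hω2
  have t2 : (lam * a ^ 4 / 4) ^ 2 ≤ lam ^ 2 * (1 + a ^ 8 + b ^ 8) := by
    have e : (lam * a ^ 4 / 4) ^ 2 = lam ^ 2 * (a ^ 8 / 16) := by ring
    rw [e]
    exact mul_le_mul_of_nonneg_left (by linarith) hl2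
  have t3 : ((b - a) ^ 2 / 4) ^ 2 ≤ 1 + a ^ 8 + b ^ 8 := by
    have e : ((b - a) ^ 2 / 4) ^ 2 = (b - a) ^ 4 / 16 := by ring
    rw [e]
    linarith
  have t4 : (β * (b - a) ^ 4 / 8) ^ 2 ≤ β ^ 2 * (2 * (1 + a ^ 8 + b ^ 8)) := by
    have e : (β * (b - a) ^ 4 / 8) ^ 2 = β ^ 2 * ((b - a) ^ 8 / 64) := by ring
    rw [e]
    exact mul_le_mul_of_nonneg_left (by linarith) hβ2
  have step := sq_add_four_le (ω₂ * a ^ 2 / 2) (lam * a ^ 4 / 4) ((b - a) ^ 2 / 4) (β * (b - a) ^ 4 / 8)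
  have hfin : 4 * (ω₂ ^ 2 * (1 + a ^ 8 + b ^ 8) + lam ^ 2 * (1 + a ^ 8 + b ^ 8) + (1 + a ^ 8 + b ^ 8) +
      β ^ 2 * (2 * (1 + a ^ 8 + b ^ 8))) ≤ (4 * (ω₂ ^ 2 + lam ^ 2) + 2 ^ 10 * (1 + β ^ 2)) * (1 + a ^ 8 + b ^ 8) := by
    have e : (4 * (ω₂ ^ 2 + lam ^ 2) + 2 ^ 10 * (1 + β ^ 2)) * (1 + a ^ 8 + b ^ 8) -
        4 * (ω₂ ^ 2 * (1 + a ^ 8 + b ^ 8) + lam ^ 2 * (1 + a ^ 8 + b ^ 8) + (1 + a ^ 8 + b ^ 8) +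
          β ^ 2 * (2 * (1 + a ^ 8 + b ^ 8))) =
        1020 * (1 + a ^ 8 + b ^ 8) + 1016 * (β ^ 2 * (1 + a ^ 8 + b ^ 8)) := by ring
    have h2 : 0 ≤ β ^ 2 * (1 + a ^ 8 + b ^ 8) := mul_nonneg hβ2 hM0
    linarith
  calc (ω₂ * a ^ 2 / 2 + lam * a ^ 4 / 4 + ((b - a) ^ 2 / 2 + β * (b - a) ^ 4 / 4) / 2) ^ 2
      = (ω₂ * a ^ 2 / 2 + lam * a ^ 4 / 4 + (b - a) ^ 2 / 4 + β * (b - a) ^ 4 / 8) ^ 2 := by ring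
    _ ≤ 4 * ((ω₂ * a ^ 2 / 2) ^ 2 + (lam * a ^ 4 / 4) ^ 2 + ((b - a) ^ 2 / 4) ^ 2 +
          (β * (b - a) ^ 4 / 8) ^ 2) := step
    _ ≤ 4 * (ω₂ ^ 2 * (1 + a ^ 8 + b ^ 8) + lam ^ 2 * (1 + a ^ 8 + b ^ 8) + (1 + a ^ 8 + b ^ 8) +
          β ^ 2 * (2 * (1 + a ^ 8 + b ^ 8))) := by linarith
    _ ≤ (4 * (ω₂ ^ 2 + lam ^ 2) + 2 ^ 10 * (1 + β ^ 2)) * (1 + a ^ 8 + b ^ 8) := hfin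

/-- **The static stubs compose**: `E_{μ_T^N}[e₀²] ≤ 3T²/2 + 2A(1 + 2C)` for every `N ≥ 2`, from the Gaussian
momentum moment and the uniform position moments (`e₀² ≤ p₀⁴/2 + 2(U + V/2)²`, `integral_mono_of_nonneg`). -/
theorem siteEnergyMoment_le_of_moments {ω₂ lam β γ T : ℝ} (hω : 0 < ω₂) (hl : 0 < lam) (hβ : 0 < β)
    (hT : 0 < T) {C : ℝ} {N : ℕ} (hN : 1 < N)
    (hp : Integrable (fun z : PhaseSpace N => (z.2 ⟨0, Nat.zero_lt_of_lt hN⟩) ^ 4)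
        ((pinnedChain ω₂ lam β γ).gibbsMeasure N T) ∧
      ∫ z, (z.2 ⟨0, Nat.zero_lt_of_lt hN⟩) ^ 4 ∂((pinnedChain ω₂ lam β γ).gibbsMeasure N T) ≤ 3 * T ^ 2)
    (hq : Integrable (fun z : PhaseSpace N => (z.1 ⟨0, Nat.zero_lt_of_lt hN⟩) ^ 8)
          ((pinnedChain ω₂ lam β γ).gibbsMeasure N T) ∧
        Integrable (fun z : PhaseSpace N => (z.1 ⟨1, hN⟩) ^ 8) ((pinnedChain ω₂ lam β γ).gibbsMeasure N T) ∧
        ∫ z, (z.1 ⟨0, Nat.zero_lt_of_lt hN⟩) ^ 8 ∂((pinnedChain ω₂ lam β γ).gibbsMeasure N T) ≤ C ∧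
        ∫ z, (z.1 ⟨1, hN⟩) ^ 8 ∂((pinnedChain ω₂ lam β γ).gibbsMeasure N T) ≤ C) :
    siteEnergyMoment ω₂ lam β γ T N ≤
      3 * T ^ 2 / 2 + 2 * (4 * (ω₂ ^ 2 + lam ^ 2) + 2 ^ 10 * (1 + β ^ 2)) * (1 + C + C) := by
  set μ := (pinnedChain ω₂ lam β γ).gibbsMeasure N T with hμ
  haveI : IsProbabilityMeasure μ :=
    Literature.MathematicalPhysics.KineticTheory.HeatConduction.pinnedChain_isProbabilityMeasure_gibbsMeasure
      hω hl.le hβ.le γ N hT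
  set A : ℝ := 4 * (ω₂ ^ 2 + lam ^ 2) + 2 ^ 10 * (1 + β ^ 2) with hA
  have hA0 : 0 ≤ A := by positivity
  obtain ⟨hp4, hp4le⟩ := hp
  obtain ⟨hq0, hq1, hq0le, hq1le⟩ := hq
  -- the dominating integrable function
  set g : PhaseSpace N → ℝ := fun z =>
    (z.2 ⟨0, Nat.zero_lt_of_lt hN⟩) ^ 4 / 2 +
      2 * (A * (1 + (z.1 ⟨0, Nat.zero_lt_of_lt hN⟩) ^ 8 + (z.1 ⟨1, hN⟩) ^ 8)) with hg
  have hgi : Integrable g μ := by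
    have h1 : Integrable (fun z : PhaseSpace N => (z.2 ⟨0, Nat.zero_lt_of_lt hN⟩) ^ 4 / 2) μ :=
      hp4.div_const 2
    have h2 : Integrable (fun z : PhaseSpace N =>
        2 * (A * (1 + (z.1 ⟨0, Nat.zero_lt_of_lt hN⟩) ^ 8 + (z.1 ⟨1, hN⟩) ^ 8))) μ :=
      ((((integrable_const (1 : ℝ)).add hq0).add hq1).const_mul A).const_mul 2
    exact h1.add h2
  have hpt : ∀ z : PhaseSpace N, (siteEnergy₀ ω₂ lam β γ N z) ^ 2 ≤ g z := by
    intro z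
    simp only [siteEnergy₀, dif_pos hN, hg]
    have hW := potentialEnergy_sq_le ω₂ lam β γ (z.1 ⟨0, Nat.zero_lt_of_lt hN⟩) (z.1 ⟨1, hN⟩)
    set W := (pinnedChain ω₂ lam β γ).U (z.1 ⟨0, Nat.zero_lt_of_lt hN⟩) +
      (pinnedChain ω₂ lam β γ).V (z.1 ⟨1, hN⟩ - z.1 ⟨0, Nat.zero_lt_of_lt hN⟩) / 2 with hWdef
    set x := z.2 ⟨0, Nat.zero_lt_of_lt hN⟩ with hx
    have e : x ^ 2 / 2 + (pinnedChain ω₂ lam β γ).U (z.1 ⟨0, Nat.zero_lt_of_lt hN⟩) +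
        (pinnedChain ω₂ lam β γ).V (z.1 ⟨1, hN⟩ - z.1 ⟨0, Nat.zero_lt_of_lt hN⟩) / 2 = x ^ 2 / 2 + W := by
      rw [hWdef]; ring
    rw [e]
    have h2 : (x ^ 2 / 2 + W) ^ 2 ≤ 2 * (x ^ 2 / 2) ^ 2 + 2 * W ^ 2 := by nlinarith [sq_nonneg (x ^ 2 / 2 - W)]
    have h3 : 2 * (x ^ 2 / 2) ^ 2 = x ^ 4 / 2 := by ring
    rw [← hA] at hW
    linarith
  have hnn : 0 ≤ᵐ[μ] fun z => (siteEnergy₀ ω₂ lam β γ N z) ^ 2 := Eventually.of_forall fun z => sq_nonneg _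
  have hmono : ∫ z, (siteEnergy₀ ω₂ lam β γ N z) ^ 2 ∂μ ≤ ∫ z, g z ∂μ :=
    integral_mono_of_nonneg hnn hgi (Eventually.of_forall hpt)
  have hgval : ∫ z, g z ∂μ =
      (∫ z, (z.2 ⟨0, Nat.zero_lt_of_lt hN⟩) ^ 4 ∂μ) / 2 +
        2 * (A * (1 + ∫ z, (z.1 ⟨0, Nat.zero_lt_of_lt hN⟩) ^ 8 ∂μ + ∫ z, (z.1 ⟨1, hN⟩) ^ 8 ∂μ)) := by
    have h1 : Integrable (fun z : PhaseSpace N => (z.2 ⟨0, Nat.zero_lt_of_lt hN⟩) ^ 4 / 2) μ :=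
      hp4.div_const 2
    have h01 : Integrable (fun z : PhaseSpace N => (1 : ℝ) + (z.1 ⟨0, Nat.zero_lt_of_lt hN⟩) ^ 8) μ :=
      (integrable_const (1 : ℝ)).add hq0
    have h012 : Integrable (fun z : PhaseSpace N =>
        (1 : ℝ) + (z.1 ⟨0, Nat.zero_lt_of_lt hN⟩) ^ 8 + (z.1 ⟨1, hN⟩) ^ 8) μ := h01.add hq1
    have h2 : Integrable (fun z : PhaseSpace N =>
        2 * (A * (1 + (z.1 ⟨0, Nat.zero_lt_of_lt hN⟩) ^ 8 + (z.1 ⟨1, hN⟩) ^ 8))) μ :=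
      (h012.const_mul A).const_mul 2
    rw [hg, integral_add h1 h2, integral_const_mul, integral_const_mul, integral_add h01 hq1,
      integral_add (integrable_const _) hq0, integral_const, integral_div]
    simp
  rw [hgval] at hmono
  unfold siteEnergyMoment
  have hb1 : (∫ z, (z.2 ⟨0, Nat.zero_lt_of_lt hN⟩) ^ 4 ∂μ) / 2 ≤ 3 * T ^ 2 / 2 := by linarith
  have hb2 : A * (1 + ∫ z, (z.1 ⟨0, Nat.zero_lt_of_lt hN⟩) ^ 8 ∂μ + ∫ z, (z.1 ⟨1, hN⟩) ^ 8 ∂μ) ≤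
      A * (1 + C + C) := mul_le_mul_of_nonneg_left (by linarith) hA0
  linarith

/-- **`LocalEnergyMoment` from the two static stubs.** -/
theorem localEnergyMoment_holds : LocalEnergyMoment := by
  intro ω₂ lam β γ hω hl hβ hγ T hT
  obtain ⟨C, hC⟩ := stub_gibbsPositionEighthMoment ω₂ lam β γ hω hl hβ hγ T hT
  refine ⟨3 * T ^ 2 / 2 + 2 * (4 * (ω₂ ^ 2 + lam ^ 2) + 2 ^ 10 * (1 + β ^ 2)) * (1 + C + C), fun N hN => ?_⟩
  have h1 : 1 < N := hN
  exact siteEnergyMoment_le_of_moments hω hl hβ hT h1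
    (stub_gibbsMomentumFourthMoment ω₂ lam β γ hω hl hβ hγ T hT N (Nat.zero_lt_of_lt h1)) (hC N h1)

/-! ## Cross-route bridge (sorry-free; documentation of shared staffing, not used by the composition) -/

/-- Verbatim check: `BoundaryEscapeDeficit.HalfChainTailLaw` (stmt-12235) is a statement about the same deficit curve
`1 − stepResponse`: its upper half is the `M → ∞` shadow of `DeficitUpperTail`. -/
example : HalfChainTailLaw ↔ ∀ ω₂ lam β γ : ℝ, 0 < ω₂ → 0 < lam → 0 < β → 0 < γ → ∀ T : ℝ, 0 < T →
    ∃ c C t₀ : ℝ, 0 < c ∧ 0 < t₀ ∧ ∀ t : ℝ, t₀ ≤ t → ∀ᶠ M : ℕ in Filter.atTop,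
      c / Real.sqrt t ≤ 1 - stepResponse ω₂ lam β γ T M t ∧
        1 - stepResponse ω₂ lam β γ T M t ≤ C / Real.sqrt t := Iff.rfl

/-- `DeficitUpperTail` implies the UPPER half of `HalfChainTailLaw` quantitatively: for `t ≥ 1` the bound
`1 − θ_M(t) ≤ C/√t` holds for every `M ≥ max N₀ ⌈√(t/c)⌉₊` (documentation of the shadow; not used below). -/
theorem halfChainUpperTail_of_deficitUpperTail (h : DeficitUpperTail) :
    ∀ ω₂ lam β γ : ℝ, 0 < ω₂ → 0 < lam → 0 < β → 0 < γ → ∀ T : ℝ, 0 < T →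
      ∃ C : ℝ, ∀ t : ℝ, 1 ≤ t → ∀ᶠ M : ℕ in Filter.atTop,
        1 - stepResponse ω₂ lam β γ T M t ≤ C / Real.sqrt t := by
  intro ω₂ lam β γ hω hl hβ hγ T hT
  obtain ⟨C, c, hc, N₀, hC⟩ := h ω₂ lam β γ hω hl hβ hγ T hT
  refine ⟨C, fun t ht => ?_⟩
  have hev : ∀ᶠ M : ℕ in atTop, t ≤ c * (M : ℝ) ^ 2 := by
    have : Tendsto (fun M : ℕ => c * (M : ℝ) ^ 2) atTop atTop := by
      apply Tendsto.const_mul_atTop hc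
      exact (tendsto_pow_atTop two_ne_zero).comp tendsto_natCast_atTop_atTop
    exact this.eventually_ge_atTop t
  filter_upwards [hev, eventually_ge_atTop N₀] with M hM hMN₀
  exact hC M hMN₀ t ht hM

/-! ## Composition (sorry-free) -/

/-- **Pointwise tail ⇒ Cesàro deficit bound.** For `N ≥ 1` and `1 ≤ t ≤ cN²`: if `1 − θ_N(s) ≤ C/√s` on `[1, cN²]`
then `∫₀ᵗ (1 − θ_N) ≤ (1 + 2γ + 2 max(C,0)) √t` — the initial stretch `[0,1]` costs at most `1 + 2γ`
(`one_sub_stepResponse_le`), the tail `∫₁ᵗ max(C,0)/√s ds = 2 max(C,0)(√t − 1)`. Interval-integrability of the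
continuous deficit curve is supplied by `continuous_stepResponse`. -/
theorem deficitIntegral_le_of_upperTail {ω₂ lam β γ T : ℝ} (hω : 0 < ω₂) (hl : 0 < lam) (hβ : 0 < β) (hγ : 0 < γ)
    (hT : 0 < T) {N : ℕ} (hN : 0 < N) {t C c : ℝ} (ht : 1 ≤ t) (htc : t ≤ c * (N : ℝ) ^ 2)
    (htail : ∀ s : ℝ, 1 ≤ s → s ≤ c * (N : ℝ) ^ 2 → 1 - stepResponse ω₂ lam β γ T N s ≤ C / Real.sqrt s) :
    deficitIntegral ω₂ lam β γ T N t ≤ (1 + 2 * γ + 2 * max C 0) * Real.sqrt t := by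
  set f : ℝ → ℝ := fun s => 1 - stepResponse ω₂ lam β γ T N s with hf
  have hfc : Continuous f := continuous_const.sub (continuous_stepResponse hω hl hβ hγ hT hN)
  have hfi : ∀ a b : ℝ, IntervalIntegrable f volume a b := fun a b => hfc.intervalIntegrable a b
  have ht0 : 0 ≤ t := le_trans zero_le_one ht
  have hsqrt1 : 1 ≤ Real.sqrt t := by rw [← Real.sqrt_one]; exact Real.sqrt_le_sqrt ht
  have hsqrt0 : 0 ≤ Real.sqrt t := Real.sqrt_nonneg t
  set C' : ℝ := max C 0 with hC'
  have hC'0 : 0 ≤ C' := le_max_right _ _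
  -- split the Cesàro integral at `s = 1`
  have hsplit : deficitIntegral ω₂ lam β γ T N t = (∫ s in (0 : ℝ)..1, f s) + ∫ s in (1 : ℝ)..t, f s := by
    unfold deficitIntegral
    rw [intervalIntegral.integral_add_adjacent_intervals (hfi 0 1) (hfi 1 t)]
  -- initial stretch
  have h01 : ∫ s in (0 : ℝ)..1, f s ≤ 1 + 2 * γ := by
    have hmono : ∫ s in (0 : ℝ)..1, f s ≤ ∫ s in (0 : ℝ)..1, (1 + 2 * γ : ℝ) := by
      refine intervalIntegral.integral_mono_on zero_le_one (hfi 0 1) intervalIntegrable_const fun s hs => ?_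
      have h1 := one_sub_stepResponse_le hω hl hβ hγ hT hN hs.1
      have h2 : 2 * γ * s ≤ 2 * γ := by nlinarith [hs.2, hγ.le]
      simp only [hf]
      linarith
    rw [intervalIntegral.integral_const, sub_zero, smul_eq_mul, one_mul] at hmono
    exact hmono
  -- the tail
  have h1t : ∫ s in (1 : ℝ)..t, f s ≤ 2 * C' * Real.sqrt t := by
    have hg : ∀ s ∈ Set.uIcc (1 : ℝ) t, HasDerivAt (fun x => 2 * C' * Real.sqrt x) (C' / Real.sqrt s) s := by
      intro s hs
      rw [Set.uIcc_of_le ht] at hs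
      have hs0 : s ≠ 0 := by linarith [hs.1]
      have hd := (Real.hasDerivAt_sqrt hs0).const_mul (2 * C')
      have e : 2 * C' * (1 / (2 * Real.sqrt s)) = C' / Real.sqrt s := by
        have : Real.sqrt s ≠ 0 := Real.sqrt_ne_zero'.2 (by linarith [hs.1])
        field_simp
      rw [e] at hd
      exact hd
    have hgc : ContinuousOn (fun s => C' / Real.sqrt s) (Set.uIcc (1 : ℝ) t) := by
      refine continuousOn_const.div Real.continuous_sqrt.continuousOn fun s hs => ?_
      rw [Set.uIcc_of_le ht] at hs
      exact Real.sqrt_ne_zero'.2 (by linarith [hs.1])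
    have hgi : IntervalIntegrable (fun s => C' / Real.sqrt s) volume 1 t := hgc.intervalIntegrable
    have hFTC : ∫ s in (1 : ℝ)..t, C' / Real.sqrt s = 2 * C' * Real.sqrt t - 2 * C' * Real.sqrt 1 :=
      intervalIntegral.integral_eq_sub_of_hasDerivAt hg hgi
    have hmono : ∫ s in (1 : ℝ)..t, f s ≤ ∫ s in (1 : ℝ)..t, C' / Real.sqrt s := by
      refine intervalIntegral.integral_mono_on ht (hfi 1 t) hgi fun s hs => ?_
      have hsc : s ≤ c * (N : ℝ) ^ 2 := hs.2.trans htc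
      have h1 := htail s hs.1 hsc
      have hs0 : 0 < Real.sqrt s := Real.sqrt_pos.2 (by linarith [hs.1])
      have h2 : C / Real.sqrt s ≤ C' / Real.sqrt s := div_le_div_of_nonneg_right (le_max_left _ _) hs0.le
      simp only [hf]
      exact h1.trans h2
    rw [hFTC, Real.sqrt_one] at hmono
    have : 0 ≤ 2 * C' := by positivity
    linarith
  rw [hsplit]
  calc (∫ s in (0 : ℝ)..1, f s) + ∫ s in (1 : ℝ)..t, f s ≤ (1 + 2 * γ) + 2 * C' * Real.sqrt t := by linarith
    _ ≤ (1 + 2 * γ) * Real.sqrt t + 2 * C' * Real.sqrt t := by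
        have : 0 ≤ 1 + 2 * γ := by positivity
        nlinarith
    _ = (1 + 2 * γ + 2 * C') * Real.sqrt t := by ring

/-- **Bridge for the pointwise suppliers** (triad line, card A's `C⁺`): `DeficitUpperTail → DeficitCesaroEW` with
`C ↦ 1 + 2γ + 2 max(C,0)`, same `c`, threshold `max N₀ 1`. -/
theorem deficitCesaroEW_of_upperTail (h : DeficitUpperTail) : DeficitCesaroEW := by
  intro ω₂ lam β γ hω hl hβ hγ T hT
  obtain ⟨C, c, hc, N₀, hC⟩ := h ω₂ lam β γ hω hl hβ hγ T hT
  refine ⟨1 + 2 * γ + 2 * max C 0, c, hc, max N₀ 1, fun N hN t ht htc => ?_⟩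
  have hN₀ : N₀ ≤ N := le_trans (le_max_left _ _) hN
  have hN1 : 0 < N := lt_of_lt_of_le Nat.one_pos (le_trans (le_max_right _ _) hN)
  exact deficitIntegral_le_of_upperTail hω hl hβ hγ hT hN1 ht htc (fun s hs hsc => hC N hN₀ s hs hsc)

/-- The def-level statements give (S) at the bath bond, pointwise in the parameters: for `N ≥ 2` in the
window, `V_N(0,t) ≤ (4γT² max(C,0) + 8 max(σ²,0)) √t` (`√t ≥ 1` absorbs the static term). -/
theorem bondHeatVar_le_of_parts {ω₂ lam β γ T : ℝ} (hγ : 0 < γ) {N : ℕ} {t C σ2 : ℝ} (ht : 1 ≤ t)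
    (hred : bondHeatVar ω₂ lam β γ T N 0 t ≤
      4 * γ * T ^ 2 * deficitIntegral ω₂ lam β γ T N t + 8 * siteEnergyMoment ω₂ lam β γ T N)
    (hmom : siteEnergyMoment ω₂ lam β γ T N ≤ σ2)
    (hces : deficitIntegral ω₂ lam β γ T N t ≤ C * Real.sqrt t) :
    bondHeatVar ω₂ lam β γ T N 0 t ≤ (4 * γ * T ^ 2 * max C 0 + 8 * max σ2 0) * Real.sqrt t := by
  have hsqrt : 1 ≤ Real.sqrt t := by
    rw [← Real.sqrt_one]
    exact Real.sqrt_le_sqrt ht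
  have hsqrt0 : 0 ≤ Real.sqrt t := Real.sqrt_nonneg t
  have hγT : 0 ≤ 4 * γ * T ^ 2 := by positivity
  have hdef : deficitIntegral ω₂ lam β γ T N t ≤ max C 0 * Real.sqrt t :=
    hces.trans (mul_le_mul_of_nonneg_right (le_max_left _ _) hsqrt0)
  have h2 : siteEnergyMoment ω₂ lam β γ T N ≤ max σ2 0 * Real.sqrt t :=
    calc siteEnergyMoment ω₂ lam β γ T N ≤ max σ2 0 := hmom.trans (le_max_left _ _)
      _ = max σ2 0 * 1 := (mul_one _).symm
      _ ≤ max σ2 0 * Real.sqrt t := mul_le_mul_of_nonneg_left hsqrt (le_max_right _ _)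
  have h1 := mul_le_mul_of_nonneg_left hdef hγT
  calc bondHeatVar ω₂ lam β γ T N 0 t
      ≤ 4 * γ * T ^ 2 * deficitIntegral ω₂ lam β γ T N t + 8 * siteEnergyMoment ω₂ lam β γ T N := hred
    _ ≤ 4 * γ * T ^ 2 * (max C 0 * Real.sqrt t) + 8 * (max σ2 0 * Real.sqrt t) := by linarith
    _ = (4 * γ * T ^ 2 * max C 0 + 8 * max σ2 0) * Real.sqrt t := by ring

/-- **The skeleton concludes the crux BY NAME — through the LANDED transfer.** `SubdiffusiveBondHeat` (route
`BondHeatUncertainty`, stmt-AtomisticToContinuum-9120) is the landed theorem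
`Theorems.SubdiffusiveBondHeat.subdiffusiveBondHeat_of_deficitCesaroEW` (p96625, file
`Theorems/BondHeatUncertaintySubdiffusiveBondHeatOfDeficitCesaroEW.lean`, registered sub-goal) applied to the one open stub:
the moment `stub_deficitCesaroEW` lands under `Theorems/` with its registered signature, this line closes the crux by the same
one-liner. -/
theorem SubdiffusiveBondHeat_of : SubdiffusiveBondHeat :=
  Summit.AtomisticToContinuum.FouriersLaw.Theorems.SubdiffusiveBondHeat.subdiffusiveBondHeat_of_deficitCesaroEW
    stub_deficitCesaroEW

/-- The same conclusion through this file's own def-level composition (kept as a check that the local abbreviations agree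
with the landed transfer): witness bond `b = 0`, constants `4γT² max(C,0) + 8 max(σ²,0)`. -/
theorem SubdiffusiveBondHeat_of' : SubdiffusiveBondHeat := by
  intro ω₂ lam β γ hω hl hβ hγ T hT
  obtain ⟨σ2, hσ⟩ := localEnergyMoment_holds ω₂ lam β γ hω hl hβ hγ T hT
  obtain ⟨C, c, hc, N₀, hC⟩ := deficitCesaroEW_holds ω₂ lam β γ hω hl hβ hγ T hT
  refine ⟨4 * γ * T ^ 2 * max C 0 + 8 * max σ2 0, c, hc, max N₀ 2, fun N hN => ⟨0, ?_, fun t ht htc => ?_⟩⟩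
  · have h2 : 2 ≤ N := le_trans (le_max_right _ _) hN
    omega
  · have h2 : 2 ≤ N := le_trans (le_max_right _ _) hN
    have hN₀ : N₀ ≤ N := le_trans (le_max_left _ _) hN
    have ht0 : 0 ≤ t := le_trans zero_le_one ht
    exact bondHeatVar_le_of_parts hγ ht (bathBondReduction_holds ω₂ lam β γ hω hl hβ hγ T hT N h2 t ht0) (hσ N h2)
      (hC N hN₀ t ht htc)

/-! ## Spectral bridge (lead c5, 2026-08-17; sorry-free; documentation of the landed transfer, not used by `SubdiffusiveBondHeat_of`) -/

/-- **`ContactWarburgModulus`** (crux-strategist s2's S⁺_G, `Cruxes/SubdiffusiveBondHeat/StrategistSpectralSketch.lean`; VERBATIM the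
hypothesis of the landed `transientEW_of_contactWarburgModulus`): a `√|ω|` WARBURG CUSP bound on the dip of the boundary noise spectrum
below its DC value, `M_N(ω) = (γ/T²)∫_{(0,∞)}(1 − cos ωu)K_N(u)du ≤ C√|ω|` for `|ω| ≤ 1`, uniformly in `N ≥ N₀`.  Strictly stronger than the
EW-transient half of the open stub; its `|ω| > 1` half (`M_N ≤ 1 − E_N ≤ 1`) is PROVED (`warburgDip_le_one`); false for phonons; no supplier. -/
def ContactWarburgModulus : Prop :=
  ∀ ω₂ lam β γ : ℝ, 0 < ω₂ → 0 < lam → 0 < β → 0 < γ → ∀ T : ℝ, 0 < T →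
    ∃ C : ℝ, ∃ N₀ : ℕ, ∀ N : ℕ, N₀ ≤ N → ∀ ω : ℝ, |ω| ≤ 1 →
      γ / T ^ 2 * (∫ u in Set.Ioi (0 : ℝ), (1 - Real.cos (ω * u)) * kinCorr ω₂ lam β γ T N u) ≤ C * Real.sqrt |ω|

/-- **The open stub from Ohm ⊕ Warburg**: `OhmicFloor` (`E_N ≤ C₁/N`, ⟺ stmt-11071 by `boundedResponse_iff_ohmicFloor`) and
`ContactWarburgModulus` give `DeficitCesaroEW` — the landed spectral transfer `transientEW_of_contactWarburgModulus` plus the Cesàro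
bookkeeping `cesaro_le_of_floor_transient` (p138777).  A possible reshape of the one stub into {existing item 11071, S⁺_G}; NOT filed
(the planner's call: S⁺_G is stronger than what the composition consumes). -/
theorem deficitCesaroEW_of_ohmicFloor_contactWarburgModulus
    (hO : ∀ ω₂ lam β γ : ℝ, 0 < ω₂ → 0 < lam → 0 < β → 0 < γ → ∀ T : ℝ, 0 < T →
      ∃ C₁ : ℝ, ∃ N₀ : ℕ, ∀ N : ℕ, N₀ ≤ N →
        1 - γ / T ^ 2 * (∫ u in Set.Ioi (0 : ℝ), kinCorr ω₂ lam β γ T N u) ≤ C₁ / (N : ℝ))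
    (hW : ContactWarburgModulus) : DeficitCesaroEW := by
  have hT' := Summit.AtomisticToContinuum.FouriersLaw.Theorems.SubdiffusiveBondHeat.transientEW_of_contactWarburgModulus
    (fun ω₂ lam β γ hω hl hβ hγ T hT => hW ω₂ lam β γ hω hl hβ hγ T hT)
  intro ω₂ lam β γ hω hl hβ hγ T hT
  obtain ⟨C₁, N₁, hC₁⟩ := hO ω₂ lam β γ hω hl hβ hγ T hT
  obtain ⟨C₂, c, hc, N₂, hC₂⟩ := hT' ω₂ lam β γ hω hl hβ hγ T hT
  refine ⟨max C₂ 0 + max C₁ 0 * Real.sqrt c, c, hc, max (max N₁ N₂) 1, fun N hN t ht htc => ?_⟩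
  have hN₁ : N₁ ≤ N := le_trans ((le_max_left _ _).trans (le_max_left _ _)) hN
  have hN₂ : N₂ ≤ N := le_trans ((le_max_right _ _).trans (le_max_left _ _)) hN
  have hN0 : 0 < N := lt_of_lt_of_le Nat.one_pos (le_trans (le_max_right _ _) hN)
  have h := Summit.AtomisticToContinuum.FouriersLaw.Theorems.SubdiffusiveBondHeat.cesaro_le_of_floor_transient
    hN0 hc ht htc (hC₁ N hN₁) (hC₂ N hN₂ t ht htc)
  simpa only [deficitIntegral, stepResponse, kinCorr] using h

/- (S) by the spectral route is the LANDED tree theorem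
`Theorems.SubdiffusiveBondHeat.subdiffusiveBondHeat_of_boundedResponse_contactWarburgModulus : BoundedResponse → ContactWarburgModulus-inline → SubdiffusiveBondHeat`
(p170262); it is deliberately NOT restated here, because a skeleton theorem concluding the crux may carry only registered stubs as hypotheses
(`skeleton.extra-hypothesis`). -/

end Summit.AtomisticToContinuum.FouriersLaw.Cruxes.SubdiffusiveBondHeat.BathBondDeficitIntegral

end
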